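import Summits.HodgeConjecture.HodgeCM.Proofs.Pohlmann.FactorActDescent_1

/-! PORT of `HodgeCM/Proofs/Pohlmann/FactorActDescent.lean` (HodgeCMPerL run 82) — part 2: continuation of `Summits.HodgeConjecture.HodgeCM.Proofs.Pohlmann.FactorActDescent_1` (split at a top-level declaration boundary by port_pkg.py; scope re-opened below; declarations unchanged). -/

-- port_pkg: scope re-opened for this part (file-level context, then the namespace/section stack open at the cut)
noncomputable section
namespace HodgeCM
namespace Universe
open Literature.AlgebraicGeometry.Motives (CMType)
variable {U : Universe}
/-- **F2 = M35 is a theorem of `ModelAxioms` + N1 + N3 + `Fact_prodSection`.**  `M_A := t ; M ; p_Y` for a block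
section `t`; the identities are checked on `H¹` summand by summand (`hom_ext_H1`) and propagated to all positive
degrees by N1 + M3 (`pull_eq_of_pull_zero_one`); degree `0` is N3. -/
theorem fact_factorActDescends_of_prodSection (M : U.ModelAxioms) (hN1 : U.Fact_cupExterior)
    (hN3 : U.Fact_pull_H0) (hS : U.Fact_prodSection) : U.Fact_factorActDescends := by
  intro F n m Ξ pA pB hP a Ma
  obtain ⟨t, ht⟩ := exists_isBlockSectionA M hS F n m Ξ
  obtain ⟨u, hu⟩ := exists_isBlockSectionB M hS F n m Ξ
  -- the data in applied form
  have hPA : ∀ (j : Fin (n + 1)) (k : ℕ) (y : U.Coh (U.cmAV F (blkA Ξ j)) k),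
      U.pull pA k (U.pull (U.prj n (fun i => U.cmAV F (blkA Ξ i)) j) k y) =
        U.pull (U.prj (n + 1 + m) (fun k => U.cmAV F (Ξ k)) (Fin.castAdd (m + 1) j)) k y :=
    fun j k y => LinearMap.congr_fun (hP.1 j k) y
  have hPB : ∀ (i : Fin (m + 1)) (k : ℕ) (y : U.Coh (U.cmAV F (blkB Ξ i)) k),
      U.pull pB k (U.pull (U.prj m (fun i => U.cmAV F (blkB Ξ i)) i) k y) =
        U.pull (U.prj (n + 1 + m) (fun k => U.cmAV F (Ξ k)) (Fin.natAdd (n + 1) i)) k y :=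
    fun i k y => LinearMap.congr_fun (hP.2 i k) y
  have htA : ∀ (j : Fin (n + 1)) (k : ℕ) (y : U.Coh (U.cmAV F (blkA Ξ j)) k),
      U.pull t k (U.pull (U.prj (n + 1 + m) (fun k => U.cmAV F (Ξ k)) (Fin.castAdd (m + 1) j)) k y) =
        U.pull (U.prj n (fun i => U.cmAV F (blkA Ξ i)) j) k y :=
    fun j k y => LinearMap.congr_fun (ht j k) y
  have huB : ∀ (i : Fin (m + 1)) (k : ℕ) (y : U.Coh (U.cmAV F (blkB Ξ i)) k),
      U.pull u k (U.pull (U.prj (n + 1 + m) (fun k => U.cmAV F (Ξ k)) (Fin.natAdd (n + 1) i)) k y) =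
        U.pull (U.prj m (fun i => U.cmAV F (blkB Ξ i)) i) k y :=
    fun i k y => LinearMap.congr_fun (hu i k) y
  refine ⟨fun j hM => ?_, fun i hM => ?_⟩
  · -- the `Y`-block; the factor action in applied form
    have hMj : ∀ y : U.Coh (U.cmAV F (blkA Ξ j)) 1,
        U.pull Ma 1 (U.pull (U.prj (n + 1 + m) (fun k => U.cmAV F (Ξ k)) (Fin.castAdd (m + 1) j)) 1 y) =
          U.pull (U.prj (n + 1 + m) (fun k => U.cmAV F (Ξ k)) (Fin.castAdd (m + 1) j)) 1
            ((U.cmAct F (blkA Ξ j)).ι a y) :=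
      fun y => LinearMap.congr_fun hM.1 y
    have hMj' : ∀ (j' : Fin (n + 1)), j' ≠ j → ∀ y : U.Coh (U.cmAV F (blkA Ξ j')) 1,
        U.pull Ma 1 (U.pull (U.prj (n + 1 + m) (fun k => U.cmAV F (Ξ k)) (Fin.castAdd (m + 1) j')) 1 y) =
          U.pull (U.prj (n + 1 + m) (fun k => U.cmAV F (Ξ k)) (Fin.castAdd (m + 1) j')) 1 y :=
      fun j' hj' y => LinearMap.congr_fun (hM.2 _ (castAdd_ne_castAdd hj')) y
    have hMi : ∀ (i : Fin (m + 1)) (y : U.Coh (U.cmAV F (blkB Ξ i)) 1),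
        U.pull Ma 1 (U.pull (U.prj (n + 1 + m) (fun k => U.cmAV F (Ξ k)) (Fin.natAdd (n + 1) i)) 1 y) =
          U.pull (U.prj (n + 1 + m) (fun k => U.cmAV F (Ξ k)) (Fin.natAdd (n + 1) i)) 1 y :=
      fun i y => LinearMap.congr_fun (hM.2 _ (natAdd_ne_castAdd i j)) y
    -- `M_A := t ; M ; p_Y`
    have hMA : ∀ (k : ℕ) (x : U.Coh (U.cmProd F (blkA Ξ)) k),
        U.pull (U.comp (U.comp t Ma) pA) k x = U.pull t k (U.pull Ma k (U.pull pA k x)) := fun k x => by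
      rw [M.pull_comp, M.pull_comp]; rfl
    have hFA : U.IsFactorAct F (blkA Ξ) j a (U.comp (U.comp t Ma) pA) := by
      refine ⟨LinearMap.ext fun y => ?_, fun j' hj' => LinearMap.ext fun y => ?_⟩
      · show U.pull (U.comp (U.comp t Ma) pA) 1 (U.pull (U.prj n (fun i => U.cmAV F (blkA Ξ i)) j) 1 y) =
          U.pull (U.prj n (fun i => U.cmAV F (blkA Ξ i)) j) 1 ((U.cmAct F (blkA Ξ j)).ι a y)
        rw [hMA, hPA, hMj, htA]
      · show U.pull (U.comp (U.comp t Ma) pA) 1 (U.pull (U.prj n (fun i => U.cmAV F (blkA Ξ i)) j') 1 y) =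
          U.pull (U.prj n (fun i => U.cmAV F (blkA Ξ i)) j') 1 y
        rw [hMA, hPA, hMj' j' hj', htA]
    have hFA1 : ∀ y : U.Coh (U.cmAV F (blkA Ξ j)) 1,
        U.pull (U.comp (U.comp t Ma) pA) 1 (U.pull (U.prj n (fun i => U.cmAV F (blkA Ξ i)) j) 1 y) =
          U.pull (U.prj n (fun i => U.cmAV F (blkA Ξ i)) j) 1 ((U.cmAct F (blkA Ξ j)).ι a y) :=
      fun y => LinearMap.congr_fun hFA.1 y
    have hFA2 : ∀ (j' : Fin (n + 1)), j' ≠ j → ∀ y : U.Coh (U.cmAV F (blkA Ξ j')) 1,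
        U.pull (U.comp (U.comp t Ma) pA) 1 (U.pull (U.prj n (fun i => U.cmAV F (blkA Ξ i)) j') 1 y) =
          U.pull (U.prj n (fun i => U.cmAV F (blkA Ξ i)) j') 1 y :=
      fun j' hj' y => LinearMap.congr_fun (hFA.2 j' hj') y
    refine ⟨⟨U.comp (U.comp t Ma) pA, hFA, fun k => ?_⟩, fun k => ?_⟩
    · -- `M^* ∘ p_Y^* = p_Y^* ∘ M_A^*`: both are pull-backs of morphisms `P → Y`; compare on `H⁰` and `H¹`
      have h0 : U.pull (U.comp Ma pA) 0 = U.pull (U.comp pA (U.comp (U.comp t Ma) pA)) 0 := by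
        rw [M.pull_comp, M.pull_comp _ _ _ pA, hN3 _ Ma, hN3 _ (U.comp (U.comp t Ma) pA), LinearMap.id_comp,
          LinearMap.comp_id]
      have h1 : U.pull (U.comp Ma pA) 1 = U.pull (U.comp pA (U.comp (U.comp t Ma) pA)) 1 := by
        refine hom_ext_H1 M fun j' y => ?_
        rw [M.pull_comp, M.pull_comp _ _ _ pA]
        simp only [LinearMap.coe_comp, Function.comp_apply]
        by_cases hj' : j' = j
        · subst hj'
          rw [hPA, hMj, hFA1]
          exact (hPA j' 1 _).symm
        · rw [hPA, hMj' j' hj', hFA2 j' hj']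
          exact (hPA j' 1 _).symm
      exact ((M.pull_comp _ _ _ Ma pA k).symm.trans (pull_eq_of_pull_zero_one M hN1 _ _ h0 h1 k)).trans
        (M.pull_comp _ _ _ pA _ k)
    · -- `M^* ∘ p_{Y'}^* = p_{Y'}^*`
      have h0 : U.pull (U.comp Ma pB) 0 = U.pull pB 0 := by
        rw [M.pull_comp, hN3 _ Ma, LinearMap.id_comp]
      have h1 : U.pull (U.comp Ma pB) 1 = U.pull pB 1 := by
        refine hom_ext_H1 M fun i y => ?_
        rw [M.pull_comp]
        simp only [LinearMap.coe_comp, Function.comp_apply]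
        rw [hPB, hMi]
      exact (M.pull_comp _ _ _ Ma pB k).symm.trans (pull_eq_of_pull_zero_one M hN1 _ _ h0 h1 k)
  · -- the `Y'`-block, symmetrically with `M_B := u ; M ; p_{Y'}`
    have hMi : ∀ y : U.Coh (U.cmAV F (blkB Ξ i)) 1,
        U.pull Ma 1 (U.pull (U.prj (n + 1 + m) (fun k => U.cmAV F (Ξ k)) (Fin.natAdd (n + 1) i)) 1 y) =
          U.pull (U.prj (n + 1 + m) (fun k => U.cmAV F (Ξ k)) (Fin.natAdd (n + 1) i)) 1
            ((U.cmAct F (blkB Ξ i)).ι a y) :=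
      fun y => LinearMap.congr_fun hM.1 y
    have hMi' : ∀ (i' : Fin (m + 1)), i' ≠ i → ∀ y : U.Coh (U.cmAV F (blkB Ξ i')) 1,
        U.pull Ma 1 (U.pull (U.prj (n + 1 + m) (fun k => U.cmAV F (Ξ k)) (Fin.natAdd (n + 1) i')) 1 y) =
          U.pull (U.prj (n + 1 + m) (fun k => U.cmAV F (Ξ k)) (Fin.natAdd (n + 1) i')) 1 y :=
      fun i' hi' y => LinearMap.congr_fun (hM.2 _ (natAdd_ne_natAdd hi')) y
    have hMj : ∀ (j : Fin (n + 1)) (y : U.Coh (U.cmAV F (blkA Ξ j)) 1),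
        U.pull Ma 1 (U.pull (U.prj (n + 1 + m) (fun k => U.cmAV F (Ξ k)) (Fin.castAdd (m + 1) j)) 1 y) =
          U.pull (U.prj (n + 1 + m) (fun k => U.cmAV F (Ξ k)) (Fin.castAdd (m + 1) j)) 1 y :=
      fun j y => LinearMap.congr_fun (hM.2 _ (natAdd_ne_castAdd i j).symm) y
    have hMB : ∀ (k : ℕ) (x : U.Coh (U.cmProd F (blkB Ξ)) k),
        U.pull (U.comp (U.comp u Ma) pB) k x = U.pull u k (U.pull Ma k (U.pull pB k x)) := fun k x => by
      rw [M.pull_comp, M.pull_comp]; rfl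
    have hFB : U.IsFactorAct F (blkB Ξ) i a (U.comp (U.comp u Ma) pB) := by
      refine ⟨LinearMap.ext fun y => ?_, fun i' hi' => LinearMap.ext fun y => ?_⟩
      · show U.pull (U.comp (U.comp u Ma) pB) 1 (U.pull (U.prj m (fun i => U.cmAV F (blkB Ξ i)) i) 1 y) =
          U.pull (U.prj m (fun i => U.cmAV F (blkB Ξ i)) i) 1 ((U.cmAct F (blkB Ξ i)).ι a y)
        rw [hMB, hPB, hMi, huB]
      · show U.pull (U.comp (U.comp u Ma) pB) 1 (U.pull (U.prj m (fun i => U.cmAV F (blkB Ξ i)) i') 1 y) =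
          U.pull (U.prj m (fun i => U.cmAV F (blkB Ξ i)) i') 1 y
        rw [hMB, hPB, hMi' i' hi', huB]
    have hFB1 : ∀ y : U.Coh (U.cmAV F (blkB Ξ i)) 1,
        U.pull (U.comp (U.comp u Ma) pB) 1 (U.pull (U.prj m (fun i => U.cmAV F (blkB Ξ i)) i) 1 y) =
          U.pull (U.prj m (fun i => U.cmAV F (blkB Ξ i)) i) 1 ((U.cmAct F (blkB Ξ i)).ι a y) :=
      fun y => LinearMap.congr_fun hFB.1 y
    have hFB2 : ∀ (i' : Fin (m + 1)), i' ≠ i → ∀ y : U.Coh (U.cmAV F (blkB Ξ i')) 1,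
        U.pull (U.comp (U.comp u Ma) pB) 1 (U.pull (U.prj m (fun i => U.cmAV F (blkB Ξ i)) i') 1 y) =
          U.pull (U.prj m (fun i => U.cmAV F (blkB Ξ i)) i') 1 y :=
      fun i' hi' y => LinearMap.congr_fun (hFB.2 i' hi') y
    refine ⟨⟨U.comp (U.comp u Ma) pB, hFB, fun k => ?_⟩, fun k => ?_⟩
    · have h0 : U.pull (U.comp Ma pB) 0 = U.pull (U.comp pB (U.comp (U.comp u Ma) pB)) 0 := by
        rw [M.pull_comp, M.pull_comp _ _ _ pB, hN3 _ Ma, hN3 _ (U.comp (U.comp u Ma) pB), LinearMap.id_comp,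
          LinearMap.comp_id]
      have h1 : U.pull (U.comp Ma pB) 1 = U.pull (U.comp pB (U.comp (U.comp u Ma) pB)) 1 := by
        refine hom_ext_H1 M fun i' y => ?_
        rw [M.pull_comp, M.pull_comp _ _ _ pB]
        simp only [LinearMap.coe_comp, Function.comp_apply]
        by_cases hi' : i' = i
        · subst hi'
          rw [hPB, hMi, hFB1]
          exact (hPB i' 1 _).symm
        · rw [hPB, hMi' i' hi', hFB2 i' hi']
          exact (hPB i' 1 _).symm
      exact ((M.pull_comp _ _ _ Ma pB k).symm.trans (pull_eq_of_pull_zero_one M hN1 _ _ h0 h1 k)).trans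
        (M.pull_comp _ _ _ pB _ k)
    · have h0 : U.pull (U.comp Ma pA) 0 = U.pull pA 0 := by
        rw [M.pull_comp, hN3 _ Ma, LinearMap.id_comp]
      have h1 : U.pull (U.comp Ma pA) 1 = U.pull pA 1 := by
        refine hom_ext_H1 M fun j y => ?_
        rw [M.pull_comp]
        simp only [LinearMap.coe_comp, Function.comp_apply]
        rw [hPA, hMj]
      exact (M.pull_comp _ _ _ Ma pA k).symm.trans (pull_eq_of_pull_zero_one M hN1 _ _ h0 h1 k)

end Universe

end HodgeCM

end
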